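import Summits.QuantumFields.BalabanUV.Beta.KernelWardHColumnStep
import Summits.QuantumFields.BalabanUV.Beta.RelInvBorderedHessianStep

/-!
# `BalabanUV.Beta.KernelWardHColumnWall` — binder row D1, the WARD binder `hW`, leaf (W-LH) INSTANTIATED: the ℋ-column Ward law of the
# wall family's Π_bm-co-dressed step resolvents `G_j := coDressKBmAt (toSite r) Lc (KInvStep Lc j)` at EVERY step `j`, constant family
# `cH j = (stepScale d Lc j · Lc^{d+1})⁻¹`

HONEST FRAMING (cell contract, verbatim): «discharging `BetaPertH` makes Bałaban's UV stability UNCONDITIONAL — a real constructive-QFT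
result; it is NOT the continuum limit and NOT the Clay problem.»  DERIVED cell leaf (pub-balaban β sub-cell, D1 formalisation swarm, seat
`b2b-balaban-beta-d1-formalise-leaf-07`): the socket `hH` of an1-g25's hW root `KernelWardRelativeEnd.wardTransversal_flipK_TbalOf_JsBalBmNAtOf_ctrC(_parity)`
(leaf (W-LH) of `HOME/b2b-balaban-beta-an1-g25/SKELETON-D1-hW.v1.md` §2) DISCHARGED for the wall family at every `j`, by composing the generic laws
`KernelWardHColumn.colH_ward_of_AME` (`j = 0`) / `KernelWardHColumnStep.colH_ward_of_AME_step` (`j + 1`) with an2-g15's relative-inverse theorems for the STRAIGHT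
candidates: `RelInvBorderedHessian.relInv_coDressKBmAt_KInvStep_zero` (`j = 0`, `bhK Lc`) and
`RelInvBorderedHessianStep.relInv_coDressKBmAt_KInvStep_succ_bhKStep` (`j + 1`, `bhKStep d Lc (j+1)`).  No statement of Bałaban's papers is typed
here, no `[cite:]` tag, no `def`, no `Prop` fact; it instantiates no binder of the β-function wall by itself ((W-LH) is one of four leaves of hW,
hW one of four binders of `OneStepKernelFamily.d1Drift_of_D1Tel_D1Rep`).  NOT `BetaPertH`; NOT continuum; NOT Clay.
HONEST DEPENDENCY (verbatim): continuum YM on T⁴ ⇐ BetaPertH ∧ nine spine estimates (0/9 proved); BetaPertH ⇐ (D1) ∧ (D4) ∧ CAP+tail;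
G-an2-4 gates asym, D1 and NE2/3/4.

Contents ([folklore] composition): `hAME_KInvStep` (rule AME of `G_j` against `bhKStep d Lc j`, every `j`, every in-block root),
**`colH_ward_KInvStep_all`** (the law, every `j`), **`hH_KInvStep`** (the same in the literal binder shape `∀ j y κ′ u, … = cH j * gaugeWt Lc y κ′ u`
with `cH := fun j => (stepScale d Lc j * Lc^(d+1))⁻¹`).  Axioms standard.  Provenance: b2b-balaban β sub-cell, D1 formalisation swarm leaf-07,
2026-08-20 (v1); over `KernelWardHColumn` / `KernelWardHColumnStep` (leaf-07) and `RelInvBorderedHessian` / `RelInvBorderedHessianStep` (an2) BY NAME; no existing file touched.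
-/

open Finset
open scoped BigOperators
open Literature.MathematicalPhysics.QuantumFieldTheory
open Literature.MathematicalPhysics.QuantumFieldTheory.Balaban1983to89
open Literature.MathematicalPhysics.QuantumFieldTheory.Balaban1983to89.Beta
open ExpKernelCalculus (MKer comp)
open AffineAveraging (box toSite)
open OneStepResolventKernel (Fib)
open OneStepKernelFamily (KInvStep colH)
open Summit.QuantumFields.BalabanUV.Beta.TameKernelCalculus
open Summit.QuantumFields.BalabanUV.Beta.ChartConjugationRelative (RelInv)
open Summit.QuantumFields.BalabanUV.Beta.AxialDressingRooted (axEc coDressKBmAt spr_coDressKBmAt one_le_of_neZero)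
open Summit.QuantumFields.BalabanUV.Beta.BorderedHessian (bhK bhKStep bhKStep_zero stepScale spr_KInvStep relInv_coDressKBmAt_KInvStep_zero
  relInv_coDressKBmAt_KInvStep_succ_bhKStep)
open Summit.QuantumFields.BalabanUV.Beta.KernelWardRelative (gaugeWt)
open Summit.QuantumFields.BalabanUV.Beta.KernelWardHColumn (colH_ward_of_AME)
open Summit.QuantumFields.BalabanUV.Beta.KernelWardHColumnStep (colH_ward_of_AME_step)

namespace Summit.QuantumFields.BalabanUV.Beta.KernelWardHColumnWall

noncomputable section

variable {d : ℕ} {Lc : ℕ} [NeZero Lc] {r : Fin (d + 1) → ℕ}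

/-- [folklore] **RULE AME OF THE WALL FAMILY'S CO-DRESSED STEP RESOLVENT AGAINST THE STRAIGHT CANDIDATE, EVERY STEP**:
`(G_j ∘ bhKStep d Lc j) ∘ axEc (toSite r) Lc = axEc (toSite r) Lc` (`j = 0`: an2's `relInv_coDressKBmAt_KInvStep_zero`, `bhKStep … 0 = bhK Lc`;
`j + 1`: an2's `relInv_coDressKBmAt_KInvStep_succ_bhKStep`). -/
theorem hAME_KInvStep (hr : r ∈ box (d + 1) Lc) :
    ∀ j : ℕ, comp (comp (coDressKBmAt (toSite r) Lc (KInvStep (d := d) Lc j)) (bhKStep d Lc j)) (axEc (toSite r) Lc) = axEc (toSite r) Lc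
  | 0 => by rw [bhKStep_zero]; exact (relInv_coDressKBmAt_KInvStep_zero hr).AME
  | j + 1 => (relInv_coDressKBmAt_KInvStep_succ_bhKStep hr j).AME

/-- [folklore] **(W-LH) FOR THE WALL FAMILY, EVERY STEP**: for every in-block root `r` and every `j`,
`Σ_μ (colH G_j Lc μ (y − e_μ) κ′ u − colH G_j Lc μ y κ′ u) = (stepScale d Lc j · Lc^{d+1})⁻¹ · gaugeWt Lc y κ′ u`,
`G_j := coDressKBmAt (toSite r) Lc (KInvStep Lc j)`. -/
theorem colH_ward_KInvStep_all (hr : r ∈ box (d + 1) Lc) (j : ℕ) (y : Fin (d + 1) → ℤ) (κ' : Fin (d + 1)) (u : Fin (d + 1) → ℤ) :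
    ∑ μ, (colH (coDressKBmAt (toSite r) Lc (KInvStep (d := d) Lc j)) Lc μ (y - B6BondElimination.unitVec μ) κ' u
        - colH (coDressKBmAt (toSite r) Lc (KInvStep (d := d) Lc j)) Lc μ y κ' u) =
      (stepScale d Lc j * (Lc : ℝ) ^ (d + 1))⁻¹ * gaugeWt Lc y κ' u := by
  have hG : Spr (coDressKBmAt (toSite r) Lc (KInvStep (d := d) Lc j)) := spr_coDressKBmAt (one_le_of_neZero Lc) hr (spr_KInvStep j)
  cases j with
  | zero =>
    have h0 : stepScale d Lc 0 = 1 := by simp [stepScale]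
    rw [h0, one_mul]
    exact colH_ward_of_AME hG (relInv_coDressKBmAt_KInvStep_zero hr).AME y κ' u
  | succ j => exact colH_ward_of_AME_step j hG (hAME_KInvStep hr (j + 1)) y κ' u

/-- [folklore] **THE SOCKET `hH` OF THE hW ROOT, LITERALLY**: with `cH := fun j => (stepScale d Lc j * Lc^(d+1))⁻¹`,
`∀ j y κ′ u, Σ_μ (colH G_j Lc μ (y − e_μ) κ′ u − colH G_j Lc μ y κ′ u) = cH j * gaugeWt Lc y κ′ u` (at `d = 3`, `r := ctrOff 4 Lc`: the binder of
`KernelWardRelativeEnd.wardTransversal_flipK_TbalOf_JsBalBmNAtOf_ctrC(_parity)`). -/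
theorem hH_KInvStep (hr : r ∈ box (d + 1) Lc) :
    ∀ (j : ℕ) (y : Fin (d + 1) → ℤ) (κ' : Fin (d + 1)) (u : Fin (d + 1) → ℤ),
      ∑ μ, (colH (coDressKBmAt (toSite r) Lc (KInvStep (d := d) Lc j)) Lc μ (y - B6BondElimination.unitVec μ) κ' u
          - colH (coDressKBmAt (toSite r) Lc (KInvStep (d := d) Lc j)) Lc μ y κ' u) =
        (fun j : ℕ => (stepScale d Lc j * (Lc : ℝ) ^ (d + 1))⁻¹) j * gaugeWt Lc y κ' u :=
  fun j y κ' u => colH_ward_KInvStep_all hr j y κ' u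

end

end Summit.QuantumFields.BalabanUV.Beta.KernelWardHColumnWall
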